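import Summits.QuantumFields.YangMills.Theorems.SmallCircleAnchorAnchorGapStubDebyeScreening18

/-!
# Crux `AnchorGap` (stmt-QuantumFields-11141), line `registered` — the Gaussian interpolation formula (B1 under stub X₀)

For a linear family of precision matrices `P + tD` on `ι → ℝ` (positive definite at `t₀`) and an
observable `F` of the polynomial-growth class:

* `hasDerivAt_gaussian_integral` — differentiation under the integral sign:
  `d/dt ∫ F e^{−½φᵀ(P+tD)φ} = −½ ∫ (φᵀDφ) F e^{−½φᵀ(P+tD)φ}` at `t₀` (domination by a product Gaussian
  on a neighbourhood of `t₀`);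
* `hasDerivAt_gaussian_expect` — **the interpolation (heat-kernel) formula** for normalised
  expectations: `d/dt ⟨F⟩_t = −½ Σ_{a,b} ((P+t₀D)⁻¹ D (P+t₀D)⁻¹)_{ab} ⟨∂_b∂_a F⟩_{t₀}`
  `= ½ Σ_{a,b} (dC/dt)_{ab} ⟨∂_a∂_b F⟩`, `C(t) = (P+tD)⁻¹` (quotient rule and
  `gaussian_wick_quadForm`; the trace terms of numerator and partition function cancel).

This is the generating identity of the Glimm–Jaffe–Spencer decoupling expansion about the
Debye–Hückel Gaussian (Brydges 1978 §3, (3.13)–(3.17)): interpolating the precision matrix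
linearly between its block-decoupled version and itself keeps positivity and factorises the
`t = 0` end over blocks.
-/

set_option autoImplicit false

noncomputable section

namespace Summit.QuantumFields.YangMills.Theorems.AnchorGap

open MeasureTheory Finset Matrix

/-- The quadratic form of a linear family is linear in the parameter. -/
private lemma quadForm_add_smul {ι : Type} [Fintype ι] (P D : Matrix ι ι ℝ) (t : ℝ) (φ : ι → ℝ) :
    φ ⬝ᵥ ((P + t • D) *ᵥ φ) = φ ⬝ᵥ (P *ᵥ φ) + t * (φ ⬝ᵥ (D *ᵥ φ)) := by
  rw [Matrix.add_mulVec, Matrix.smul_mulVec, dotProduct_add, dotProduct_smul, smul_eq_mul]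

/-- `|φᵀDφ| ≤ (Σ_{pq} |D_{pq}|) Σᵢ φᵢ²`. -/
private lemma abs_quadForm_le {ι : Type} [Fintype ι] (D : Matrix ι ι ℝ) (φ : ι → ℝ) :
    |φ ⬝ᵥ (D *ᵥ φ)| ≤ (∑ p, ∑ q, |D p q|) * ∑ i, φ i ^ 2 := by
  have hs : ∀ j, φ j ^ 2 ≤ ∑ i, φ i ^ 2 := fun j =>
    Finset.single_le_sum (f := fun i => φ i ^ 2) (fun i _ => sq_nonneg _) (Finset.mem_univ j)
  have hprod : ∀ p q, |φ p| * |φ q| ≤ ∑ i, φ i ^ 2 := fun p q => by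
    have h2 : 2 * (|φ p| * |φ q|) ≤ φ p ^ 2 + φ q ^ 2 := by
      nlinarith [sq_nonneg (|φ p| - |φ q|), sq_abs (φ p), sq_abs (φ q)]
    nlinarith [hs p, hs q, abs_nonneg (φ p), abs_nonneg (φ q)]
  have hexp : φ ⬝ᵥ (D *ᵥ φ) = ∑ p, ∑ q, D p q * (φ p * φ q) := by
    simp only [dotProduct, Matrix.mulVec, Finset.mul_sum]
    exact Finset.sum_congr rfl fun p _ => Finset.sum_congr rfl fun q _ => by ring
  rw [hexp, Finset.sum_mul]
  refine (Finset.abs_sum_le_sum_abs _ _).trans (Finset.sum_le_sum fun p _ => ?_)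
  rw [Finset.sum_mul]
  refine (Finset.abs_sum_le_sum_abs _ _).trans (Finset.sum_le_sum fun q _ => ?_)
  rw [abs_mul, abs_mul]
  exact mul_le_mul_of_nonneg_left (hprod p q) (abs_nonneg _)

/-- The scalar matrix `a • 1` with `a > 0` is positive definite and its form is `a Σᵢ φᵢ²`. -/
private lemma smul_one_posDef {ι : Type} [Fintype ι] [DecidableEq ι] {a : ℝ} (ha : 0 < a) :
    ((a • (1 : Matrix ι ι ℝ)).PosDef) ∧ ∀ φ : ι → ℝ, φ ⬝ᵥ ((a • (1 : Matrix ι ι ℝ)) *ᵥ φ) = a * ∑ i, φ i ^ 2 := by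
  have hform : ∀ φ : ι → ℝ, φ ⬝ᵥ ((a • (1 : Matrix ι ι ℝ)) *ᵥ φ) = a * ∑ i, φ i ^ 2 := fun φ => by
    rw [Matrix.smul_mulVec, Matrix.one_mulVec, dotProduct_smul, smul_eq_mul, dotProduct]
    congr 1
    exact Finset.sum_congr rfl fun i _ => by ring
  refine ⟨Matrix.PosDef.of_dotProduct_mulVec_pos ?_ fun φ hφ => ?_, hform⟩
  · exact Matrix.isHermitian_iff_isSymm.2 (by unfold Matrix.IsSymm; simp)
  · simp only [star_trivial]
    rw [hform φ]
    obtain ⟨i, hi⟩ : ∃ i, φ i ≠ 0 := Function.ne_iff.1 hφ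
    have : 0 < ∑ j, φ j ^ 2 := lt_of_lt_of_le (by positivity : 0 < φ i ^ 2)
      (Finset.single_le_sum (f := fun j => φ j ^ 2) (fun j _ => sq_nonneg _) (Finset.mem_univ i))
    positivity

/-- **Differentiation of Gaussian integrals in the precision matrix.** For a linear family
`P + tD` of precision matrices, positive definite at `t₀`, and a measurable `F` of polynomial
growth, `t ↦ ∫ F e^{−½φᵀ(P+tD)φ} dφ` has derivative `−½ ∫ (φᵀDφ) F e^{−½φᵀ(P+t₀D)φ} dφ` at `t₀`
(differentiation under the integral sign, dominated on a neighbourhood of `t₀` by a product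
Gaussian: `φᵀ(P+tD)φ ≥ (c/2) Σφᵢ²` for `|t − t₀| (Σ|D_{pq}|) ≤ c/2`). [folklore] -/
theorem hasDerivAt_gaussian_integral :
    ∀ (ι : Type) [Fintype ι] [DecidableEq ι] (P D : Matrix ι ι ℝ) (t₀ : ℝ), (P + t₀ • D).PosDef → ∀ (m : ℕ) (K : ℝ) (F : (ι → ℝ) → ℝ), AEStronglyMeasurable F volume → (∀ φ : ι → ℝ, |F φ| ≤ K * (1 + ∑ i, φ i ^ 2) ^ m) → HasDerivAt (fun t : ℝ => ∫ φ : ι → ℝ, F φ * Real.exp (-(φ ⬝ᵥ ((P + t • D) *ᵥ φ)) / 2)) (-(1 / 2) * ∫ φ : ι → ℝ, (φ ⬝ᵥ (D *ᵥ φ)) * F φ * Real.exp (-(φ ⬝ᵥ ((P + t₀ • D) *ᵥ φ)) / 2)) t₀ := by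
  intro ι _ _ P D t₀ hQ m K F hFm hFb
  set Q : Matrix ι ι ℝ := P + t₀ • D with hQdef
  obtain ⟨c, hc, hcoer⟩ := posDef_coercive ι Q hQ
  set Λ : ℝ := ∑ p, ∑ q, |D p q| with hΛ
  have hΛ0 : 0 ≤ Λ := Finset.sum_nonneg fun p _ => Finset.sum_nonneg fun q _ => abs_nonneg _
  set δ : ℝ := c / (2 * Λ + 1) with hδ
  have hδ0 : 0 < δ := by positivity
  have hδΛ : δ * Λ ≤ c / 2 := by
    rw [hδ, div_mul_eq_mul_div, div_le_div_iff₀ (by positivity) (by positivity)]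
    nlinarith
  -- the family rebased at `t₀`
  have hreb : ∀ (t : ℝ) (φ : ι → ℝ), φ ⬝ᵥ ((P + t • D) *ᵥ φ) = φ ⬝ᵥ (Q *ᵥ φ) + (t - t₀) * (φ ⬝ᵥ (D *ᵥ φ)) := by
    intro t φ
    rw [hQdef, quadForm_add_smul, quadForm_add_smul]
    ring
  -- coercivity near `t₀`
  have hnear : ∀ t : ℝ, t ∈ Metric.ball t₀ δ → ∀ φ : ι → ℝ, c / 2 * ∑ i, φ i ^ 2 ≤ φ ⬝ᵥ ((P + t • D) *ᵥ φ) := by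
    intro t ht φ
    rw [Metric.mem_ball, Real.dist_eq] at ht
    rw [hreb]
    have h1 := hcoer φ
    have h2 := abs_quadForm_le D φ
    have hs : 0 ≤ ∑ i, φ i ^ 2 := Finset.sum_nonneg fun i _ => sq_nonneg _
    have h3 : |(t - t₀) * (φ ⬝ᵥ (D *ᵥ φ))| ≤ δ * (Λ * ∑ i, φ i ^ 2) := by
      rw [abs_mul]
      exact mul_le_mul ht.le h2 (abs_nonneg _) hδ0.le
    have h4 : δ * (Λ * ∑ i, φ i ^ 2) ≤ c / 2 * ∑ i, φ i ^ 2 := by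
      rw [← mul_assoc]; exact mul_le_mul_of_nonneg_right hδΛ hs
    have h5 := neg_abs_le ((t - t₀) * (φ ⬝ᵥ (D *ᵥ φ)))
    linarith
  -- the dominating function
  obtain ⟨hR, hRform⟩ := smul_one_posDef (ι := ι) (a := c / 2) (by positivity)
  set bound : (ι → ℝ) → ℝ := fun φ => (1 / 2 * Λ * |K| * (1 + ∑ i, φ i ^ 2) ^ (m + 1)) *
    Real.exp (-(φ ⬝ᵥ (((c / 2) • (1 : Matrix ι ι ℝ)) *ᵥ φ)) / 2) with hbound
  have hpoly_cont : Continuous fun φ : ι → ℝ => 1 / 2 * Λ * |K| * (1 + ∑ i, φ i ^ 2) ^ (m + 1) := by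
    fun_prop
  have hbound_int : Integrable bound := by
    refine integrable_polyGrowth_mul_gaussian ι _ hR (m + 1) (1 / 2 * Λ * |K|) _ hpoly_cont.aestronglyMeasurable
      fun φ => ?_
    have hs : 0 ≤ ∑ i, φ i ^ 2 := Finset.sum_nonneg fun i _ => sq_nonneg _
    rw [abs_of_nonneg (by positivity)]
  -- continuity of the weights
  have hwcont : ∀ t : ℝ, Continuous fun φ : ι → ℝ => Real.exp (-(φ ⬝ᵥ ((P + t • D) *ᵥ φ)) / 2) := fun t => by
    refine Real.continuous_exp.comp ((Continuous.neg ?_).div_const _)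
    exact continuous_id.dotProduct (Continuous.matrix_mulVec continuous_const continuous_id)
  have hqcont : Continuous fun φ : ι → ℝ => φ ⬝ᵥ (D *ᵥ φ) :=
    continuous_id.dotProduct (Continuous.matrix_mulVec continuous_const continuous_id)
  -- the derivative of the integrand
  set G' : ℝ → (ι → ℝ) → ℝ := fun t φ =>
    -(1 / 2) * ((φ ⬝ᵥ (D *ᵥ φ)) * F φ * Real.exp (-(φ ⬝ᵥ ((P + t • D) *ᵥ φ)) / 2)) with hG'
  have hdiff : ∀ (φ : ι → ℝ) (t : ℝ), HasDerivAt (fun t : ℝ => F φ * Real.exp (-(φ ⬝ᵥ ((P + t • D) *ᵥ φ)) / 2)) (G' t φ) t := by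
    intro φ t
    have h1 : HasDerivAt (fun t : ℝ => φ ⬝ᵥ (Q *ᵥ φ) + (t - t₀) * (φ ⬝ᵥ (D *ᵥ φ))) (φ ⬝ᵥ (D *ᵥ φ)) t := by
      have := (((hasDerivAt_id t).sub_const t₀).mul_const (φ ⬝ᵥ (D *ᵥ φ))).const_add (φ ⬝ᵥ (Q *ᵥ φ))
      simpa using this
    have h2 := ((h1.fun_neg.div_const 2).exp).const_mul (F φ)
    have hfun : (fun t : ℝ => F φ * Real.exp (-(φ ⬝ᵥ ((P + t • D) *ᵥ φ)) / 2)) =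
        fun t => F φ * Real.exp (-(φ ⬝ᵥ (Q *ᵥ φ) + (t - t₀) * (φ ⬝ᵥ (D *ᵥ φ))) / 2) := by
      funext t; rw [hreb]
    rw [hfun]
    refine h2.congr_deriv ?_
    rw [← hreb]
    simp only [hG']
    ring
  have key := hasDerivAt_integral_of_dominated_loc_of_deriv_le (μ := (volume : Measure (ι → ℝ)))
    (F := fun t φ => F φ * Real.exp (-(φ ⬝ᵥ ((P + t • D) *ᵥ φ)) / 2)) (F' := G') (x₀ := t₀)
    (bound := bound) (Metric.ball_mem_nhds t₀ hδ0) ?_ ?_ ?_ ?_ hbound_int ?_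
  · have hval : ∫ φ : ι → ℝ, G' t₀ φ = -(1 / 2) * ∫ φ : ι → ℝ, (φ ⬝ᵥ (D *ᵥ φ)) * F φ * Real.exp (-(φ ⬝ᵥ ((P + t₀ • D) *ᵥ φ)) / 2) := by
      rw [hG']
      exact integral_const_mul _ _
    rw [← hval]
    exact key.2
  · exact Filter.Eventually.of_forall fun t => hFm.mul (hwcont t).aestronglyMeasurable
  · exact integrable_polyGrowth_mul_gaussian ι Q hQ m K F hFm hFb
  · exact (aestronglyMeasurable_const.mul ((hqcont.aestronglyMeasurable.mul hFm).mul
      (hwcont t₀).aestronglyMeasurable))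
  · refine Filter.Eventually.of_forall fun φ t ht => ?_
    have hs : 0 ≤ ∑ i, φ i ^ 2 := Finset.sum_nonneg fun i _ => sq_nonneg _
    have hK : |F φ| ≤ |K| * (1 + ∑ i, φ i ^ 2) ^ m :=
      (hFb φ).trans (mul_le_mul_of_nonneg_right (le_abs_self K) (by positivity))
    have hq : |φ ⬝ᵥ (D *ᵥ φ)| ≤ Λ * (1 + ∑ i, φ i ^ 2) := (abs_quadForm_le D φ).trans
      (mul_le_mul_of_nonneg_left (by linarith) hΛ0)
    have hw : Real.exp (-(φ ⬝ᵥ ((P + t • D) *ᵥ φ)) / 2) ≤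
        Real.exp (-(φ ⬝ᵥ (((c / 2) • (1 : Matrix ι ι ℝ)) *ᵥ φ)) / 2) := by
      rw [hRform φ]
      exact Real.exp_le_exp.2 (by have := hnear t ht φ; linarith)
    rw [hG', hbound, Real.norm_eq_abs, abs_mul, abs_mul, abs_mul, Real.abs_exp,
      show |(-(1 / 2) : ℝ)| = 1 / 2 by norm_num]
    calc 1 / 2 * (|φ ⬝ᵥ (D *ᵥ φ)| * |F φ| * Real.exp (-(φ ⬝ᵥ ((P + t • D) *ᵥ φ)) / 2))
        ≤ 1 / 2 * ((Λ * (1 + ∑ i, φ i ^ 2)) * (|K| * (1 + ∑ i, φ i ^ 2) ^ m) *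
            Real.exp (-(φ ⬝ᵥ (((c / 2) • (1 : Matrix ι ι ℝ)) *ᵥ φ)) / 2)) := by
          gcongr
      _ = (1 / 2 * Λ * |K| * (1 + ∑ i, φ i ^ 2) ^ (m + 1)) *
            Real.exp (-(φ ⬝ᵥ (((c / 2) • (1 : Matrix ι ι ℝ)) *ᵥ φ)) / 2) := by ring
  · exact Filter.Eventually.of_forall fun φ t _ => hdiff φ t

/-- **Second moments of the Gaussian weight.** For a positive definite precision matrix `P`,
`∫ φ_p φ_q e^{−½φᵀPφ} dφ = P⁻¹_{pq} ∫ e^{−½φᵀPφ} dφ` (`gaussian_wick_two` with `F = 1`), and the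
partition function `∫ e^{−½φᵀPφ} dφ` is positive. [folklore] -/
theorem gaussian_second_moment :
    ∀ (ι : Type) [Fintype ι] [DecidableEq ι] (P : Matrix ι ι ℝ), P.PosDef → (0 < ∫ φ : ι → ℝ, Real.exp (-(φ ⬝ᵥ (P *ᵥ φ)) / 2)) ∧ ∀ p q : ι, ∫ φ : ι → ℝ, φ p * φ q * Real.exp (-(φ ⬝ᵥ (P *ᵥ φ)) / 2) = P⁻¹ p q * ∫ φ : ι → ℝ, Real.exp (-(φ ⬝ᵥ (P *ᵥ φ)) / 2) := by
  intro ι _ _ P hP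
  have hwcont : Continuous fun φ : ι → ℝ => Real.exp (-(φ ⬝ᵥ (P *ᵥ φ)) / 2) := by
    refine Real.continuous_exp.comp ((Continuous.neg ?_).div_const _)
    exact continuous_id.dotProduct (Continuous.matrix_mulVec continuous_const continuous_id)
  have hint : Integrable (fun φ : ι → ℝ => Real.exp (-(φ ⬝ᵥ (P *ᵥ φ)) / 2)) := by
    have h := integrable_polyGrowth_mul_gaussian ι P hP 0 1 (fun _ => 1) aestronglyMeasurable_const
      (fun φ => by simp)
    simpa only [one_mul] using h
  refine ⟨?_, fun p q => ?_⟩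
  · rw [integral_pos_iff_support_of_nonneg (fun φ => (Real.exp_pos _).le) hint]
    have hsupp : Function.support (fun φ : ι → ℝ => Real.exp (-(φ ⬝ᵥ (P *ᵥ φ)) / 2)) = Set.univ :=
      Set.eq_univ_of_forall fun φ => (Real.exp_pos _).ne'
    rw [hsupp]
    exact isOpen_univ.measure_pos volume Set.univ_nonempty
  · have h := gaussian_wick_two ι P hP 0 1 (fun _ => 1) (fun _ _ => 0) (fun _ _ _ => 0) aestronglyMeasurable_const
      (fun _ => aestronglyMeasurable_const) (fun _ _ => aestronglyMeasurable_const) (fun φ => by simp)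
      (fun _ φ => by simp) (fun _ _ φ => by simp)
      (fun a φ => by simpa using hasDerivAt_const (φ a) (1 : ℝ))
      (fun a b φ => by simpa using hasDerivAt_const (φ b) (0 : ℝ)) p q
    simpa using h

/-- **The Gaussian interpolation (heat-kernel) formula.** For a linear family of precision
matrices `P + tD`, positive definite at `t₀`, and `F` in the polynomial-growth class with first and
second coordinate partial derivatives in the same class, the normalised expectation
`⟨F⟩_t = ∫ F e^{−½φᵀ(P+tD)φ} / ∫ e^{−½φᵀ(P+tD)φ}` satisfies
`d/dt ⟨F⟩_t |_{t₀} = −½ Σ_{a,b} (C D C)_{ab} ⟨∂_b∂_a F⟩_{t₀}`, `C = (P+t₀D)⁻¹` — i.e.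
`½ Σ_{a,b} (dC/dt)_{ab} ⟨∂_a∂_b F⟩` since `dC/dt = −CDC` (quotient rule; the trace terms of
`gaussian_wick_quadForm` for the numerator and for the partition function cancel).  With `D` the
coupling between two groups of coordinates this is the decoupling identity of the
Glimm–Jaffe–Spencer cluster expansion. [cite: Brydges1978, §3 (3.13)–(3.17)] -/
theorem hasDerivAt_gaussian_expect :
    ∀ (ι : Type) [Fintype ι] [DecidableEq ι] (P D : Matrix ι ι ℝ) (t₀ : ℝ), (P + t₀ • D).PosDef → ∀ (m : ℕ) (K : ℝ) (F : (ι → ℝ) → ℝ) (F₁ : ι → (ι → ℝ) → ℝ) (F₂ : ι → ι → (ι → ℝ) → ℝ), AEStronglyMeasurable F volume → (∀ a : ι, AEStronglyMeasurable (F₁ a) volume) → (∀ a b : ι, AEStronglyMeasurable (F₂ a b) volume) → (∀ φ : ι → ℝ, |F φ| ≤ K * (1 + ∑ i, φ i ^ 2) ^ m) → (∀ (a : ι) (φ : ι → ℝ), |F₁ a φ| ≤ K * (1 + ∑ i, φ i ^ 2) ^ m) → (∀ (a b : ι) (φ : ι → ℝ), |F₂ a b φ| ≤ K * (1 + ∑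 i, φ i ^ 2) ^ m) → (∀ (a : ι) (φ : ι → ℝ), HasDerivAt (fun t : ℝ => F (Function.update φ a t)) (F₁ a φ) (φ a)) → (∀ (a b : ι) (φ : ι → ℝ), HasDerivAt (fun t : ℝ => F₁ a (Function.update φ b t)) (F₂ a b φ) (φ b)) → HasDerivAt (fun t : ℝ => (∫ φ : ι → ℝ, F φ * Real.exp (-(φ ⬝ᵥ ((P + t • D) *ᵥ φ)) / 2)) / ∫ φ : ι → ℝ, Real.exp (-(φ ⬝ᵥ ((P + t • D) *ᵥ φ)) / 2)) (-(1 / 2) * ∑ a : ι, ∑ b : ι, ((P + t₀ • D)⁻¹ * D * (P + t₀ • D)⁻¹) a b * ((∫ φ : ι → ℝ, F₂ a b φ * Real.exp (-(φ ⬝ᵥ ((P + t₀ • D) *ᵥ φ)) / 2)) / ∫ φ : ι → ℝ, Real.exp (-(φ ⬝ᵥ ((P + t₀ • D) *ᵥ φ)) / 2))) t₀ := by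
  intro ι _ _ P D t₀ hQ m K F F₁ F₂ hFm hF₁m hF₂m hFb hF₁b hF₂b hderiv hderiv₂
  set Q : Matrix ι ι ℝ := P + t₀ • D with hQdef
  -- derivatives of numerator and partition function
  have hN := hasDerivAt_gaussian_integral ι P D t₀ hQ m K F hFm hFb
  have hZ' := hasDerivAt_gaussian_integral ι P D t₀ hQ 0 1 (fun _ => 1) aestronglyMeasurable_const
    (fun φ => by simp)
  have hZ : HasDerivAt (fun t : ℝ => ∫ φ : ι → ℝ, Real.exp (-(φ ⬝ᵥ ((P + t • D) *ᵥ φ)) / 2))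
      (-(1 / 2) * ∫ φ : ι → ℝ, (φ ⬝ᵥ (D *ᵥ φ)) * Real.exp (-(φ ⬝ᵥ (Q *ᵥ φ)) / 2)) t₀ := by
    simpa only [one_mul, mul_one] using hZ'
  obtain ⟨hZpos, -⟩ := gaussian_second_moment ι Q hQ
  -- Wick identities at `t₀`
  have hWF := gaussian_wick_quadForm ι Q hQ m K F F₁ F₂ hFm hF₁m hF₂m hFb hF₁b hF₂b hderiv hderiv₂ D
  have hW1 := gaussian_wick_quadForm ι Q hQ 0 1 (fun _ => 1) (fun _ _ => 0) (fun _ _ _ => 0)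
    aestronglyMeasurable_const (fun _ => aestronglyMeasurable_const) (fun _ _ => aestronglyMeasurable_const)
    (fun φ => by simp) (fun _ φ => by simp) (fun _ _ φ => by simp)
    (fun a φ => by simpa using hasDerivAt_const (φ a) (1 : ℝ))
    (fun a b φ => by simpa using hasDerivAt_const (φ b) (0 : ℝ)) D
  simp only [mul_one, one_mul, zero_mul, integral_zero, mul_zero, Finset.sum_const_zero, add_zero] at hW1
  -- quotient rule
  have hquot := hN.fun_div hZ hZpos.ne'
  refine hquot.congr_deriv ?_
  rw [hWF, hW1]
  set Z : ℝ := ∫ φ : ι → ℝ, Real.exp (-(φ ⬝ᵥ (Q *ᵥ φ)) / 2) with hZdef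
  set T : ℝ := ∑ p, ∑ q, D p q * Q⁻¹ p q with hT
  set N : ℝ := ∫ φ : ι → ℝ, F φ * Real.exp (-(φ ⬝ᵥ (Q *ᵥ φ)) / 2) with hNdef
  have hsum : ∑ a, ∑ b, (Q⁻¹ * D * Q⁻¹) a b *
      ((∫ φ : ι → ℝ, F₂ a b φ * Real.exp (-(φ ⬝ᵥ (Q *ᵥ φ)) / 2)) / Z) =
      (∑ a, ∑ b, (Q⁻¹ * D * Q⁻¹) a b * ∫ φ : ι → ℝ, F₂ a b φ * Real.exp (-(φ ⬝ᵥ (Q *ᵥ φ)) / 2)) / Z := by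
    rw [Finset.sum_div]
    refine Finset.sum_congr rfl fun a _ => ?_
    rw [Finset.sum_div]
    exact Finset.sum_congr rfl fun b _ => (mul_div_assoc _ _ _).symm
  rw [hsum]
  field_simp
  ring

/-- Positivity is kept along the segment from `P` to `P + D` when both ends are positive definite. -/
private lemma posDef_segment {ι : Type} [Fintype ι] [DecidableEq ι] {P D : Matrix ι ι ℝ}
    (hP : P.PosDef) (hPD : (P + D).PosDef) {s : ℝ} (hs : s ∈ Set.Icc (0 : ℝ) 1) : (P + s • D).PosDef := by
  rcases eq_or_lt_of_le hs.1 with h0 | h0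
  · rw [← h0, zero_smul, add_zero]; exact hP
  rcases eq_or_lt_of_le hs.2 with h1 | h1
  · rw [h1, one_smul]; exact hPD
  have : P + s • D = (1 - s) • P + s • (P + D) := by
    rw [smul_add, sub_smul, one_smul]; abel
  rw [this]
  exact (hP.smul (by linarith)).add (hPD.smul h0)

/-- **The integrated Gaussian interpolation formula (one decoupling step).** For precision
matrices `P` and `P + D`, both positive definite, and `F` in the polynomial-growth class with first
and second coordinate partial derivatives in the same class,
`⟨F⟩_{P+D} − ⟨F⟩_P = ∫₀¹ (−½) Σ_{a,b} (C_s D C_s)_{ab} ⟨∂_b∂_a F⟩_{P+sD} ds`, `C_s = (P+sD)⁻¹`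
(fundamental theorem of calculus along the segment, which stays positive definite, for
`hasDerivAt_gaussian_expect`; the integrand is continuous in `s`).  With `P` the block-decoupled
part of `P + D` this is the first step of the Glimm–Jaffe–Spencer / Brydges decoupling expansion.
[cite: Brydges1978, §3 (3.13)–(3.17)] -/
theorem gaussian_interpolation :
    ∀ (ι : Type) [Fintype ι] [DecidableEq ι] (P D : Matrix ι ι ℝ), P.PosDef → (P + D).PosDef → ∀ (m : ℕ) (K : ℝ) (F : (ι → ℝ) → ℝ) (F₁ : ι → (ι → ℝ) → ℝ) (F₂ : ι → ι → (ι → ℝ) → ℝ), AEStronglyMeasurable F volume → (∀ a : ι, AEStronglyMeasurable (F₁ a) volume) → (∀ a b : ι, AEStronglyMeasurable (F₂ a b) volume) → (∀ φ : ι → ℝ, |F φ| ≤ K * (1 + ∑ i, φ i ^ 2) ^ m) → (∀ (a : ι) (φ : ι → ℝ), |F₁ a φ| ≤ K * (1 + ∑ i, φ i ^ 2) ^ m) → (∀ (a b : ι) (φ : ι → ℝ), |F₂ a b φ| ≤ K * (1 + ∑ i, φ i ^ 2) ^ m) → (∀ (a : ι) (φ : ι → ℝ), HasDerivAt (fun t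 : ℝ => F (Function.update φ a t)) (F₁ a φ) (φ a)) → (∀ (a b : ι) (φ : ι → ℝ), HasDerivAt (fun t : ℝ => F₁ a (Function.update φ b t)) (F₂ a b φ) (φ b)) → (∫ φ : ι → ℝ, F φ * Real.exp (-(φ ⬝ᵥ ((P + D) *ᵥ φ)) / 2)) / (∫ φ : ι → ℝ, Real.exp (-(φ ⬝ᵥ ((P + D) *ᵥ φ)) / 2)) - (∫ φ : ι → ℝ, F φ * Real.exp (-(φ ⬝ᵥ (P *ᵥ φ)) / 2)) / (∫ φ : ι → ℝ, Real.exp (-(φ ⬝ᵥ (P *ᵥ φ)) / 2)) = ∫ s in (0 : ℝ)..1, -(1 / 2) * ∑ a : ι, ∑ b : ι, ((P + s • D)⁻¹ * D * (P + s • D)⁻¹) a b * ((∫ φ : ι → ℝ, F₂ a b φ * Real.exp (-(φ ⬝ᵥ ((P + s • D) *ᵥ φ)) / 2)) / ∫ φ : ι → ℝ, Real.exp (-(φ ⬝ᵥ ((P + s • D) *ᵥ φ)) / 2)) := by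
  intro ι _ _ P D hP hPD m K F F₁ F₂ hFm hF₁m hF₂m hFb hF₁b hF₂b hderiv hderiv₂
  set f : ℝ → ℝ := fun t => (∫ φ : ι → ℝ, F φ * Real.exp (-(φ ⬝ᵥ ((P + t • D) *ᵥ φ)) / 2)) /
    ∫ φ : ι → ℝ, Real.exp (-(φ ⬝ᵥ ((P + t • D) *ᵥ φ)) / 2) with hf
  set f' : ℝ → ℝ := fun t => -(1 / 2) * ∑ a : ι, ∑ b : ι, ((P + t • D)⁻¹ * D * (P + t • D)⁻¹) a b *
    ((∫ φ : ι → ℝ, F₂ a b φ * Real.exp (-(φ ⬝ᵥ ((P + t • D) *ᵥ φ)) / 2)) /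
      ∫ φ : ι → ℝ, Real.exp (-(φ ⬝ᵥ ((P + t • D) *ᵥ φ)) / 2)) with hf'
  have hseg : ∀ t ∈ Set.Icc (0 : ℝ) 1, (P + t • D).PosDef := fun t ht => posDef_segment hP hPD ht
  have hderivf : ∀ t ∈ Set.uIcc (0 : ℝ) 1, HasDerivAt f (f' t) t := by
    intro t ht
    rw [Set.uIcc_of_le zero_le_one] at ht
    exact hasDerivAt_gaussian_expect ι P D t (hseg t ht) m K F F₁ F₂ hFm hF₁m hF₂m hFb hF₁b hF₂b hderiv hderiv₂
  -- continuity of the integrand on `[0,1]`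
  have hlin : Continuous fun s : ℝ => P + s • D := continuous_const.add (continuous_id.smul continuous_const)
  have hinv : ∀ t ∈ Set.Icc (0 : ℝ) 1, ContinuousAt (fun s : ℝ => (P + s • D)⁻¹) t := by
    intro t ht
    have hdet : (P + t • D).det ≠ 0 := ((Matrix.isUnit_iff_isUnit_det _).1 (hseg t ht).isUnit).ne_zero
    have h := continuousAt_matrix_inv (P + t • D)
      (by simpa using NormedRing.inverse_continuousAt (Units.mk0 _ hdet))
    exact ContinuousAt.comp (f := fun s : ℝ => P + s • D) (x := t) h hlin.continuousAt
  have hentry : ∀ a b : ι, ContinuousOn (fun s : ℝ => ((P + s • D)⁻¹ * D * (P + s • D)⁻¹) a b) (Set.Icc (0 : ℝ) 1) := by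
    intro a b
    refine continuousOn_of_forall_continuousAt fun t ht => ?_
    have hmat : ContinuousAt (fun s : ℝ => (P + s • D)⁻¹ * D * (P + s • D)⁻¹) t :=
      ((hinv t ht).mul continuousAt_const).mul (hinv t ht)
    have hab : Continuous fun M : Matrix ι ι ℝ => M a b := (continuous_apply b).comp (continuous_apply a)
    exact ContinuousAt.comp (f := fun s : ℝ => (P + s • D)⁻¹ * D * (P + s • D)⁻¹) (x := t) hab.continuousAt hmat
  have hZc : ContinuousOn (fun s : ℝ => ∫ φ : ι → ℝ, Real.exp (-(φ ⬝ᵥ ((P + s • D) *ᵥ φ)) / 2)) (Set.Icc (0 : ℝ) 1) := by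
    refine continuousOn_of_forall_continuousAt fun t ht => ?_
    have h := (hasDerivAt_gaussian_integral ι P D t (hseg t ht) 0 1 (fun _ => 1) aestronglyMeasurable_const
      (fun φ => by simp)).continuousAt
    simpa only [one_mul] using h
  have hNc : ∀ a b : ι, ContinuousOn
      (fun s : ℝ => ∫ φ : ι → ℝ, F₂ a b φ * Real.exp (-(φ ⬝ᵥ ((P + s • D) *ᵥ φ)) / 2)) (Set.Icc (0 : ℝ) 1) :=
    fun a b => continuousOn_of_forall_continuousAt fun t ht =>
      (hasDerivAt_gaussian_integral ι P D t (hseg t ht) m K (F₂ a b) (hF₂m a b) (hF₂b a b)).continuousAt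
  have hZne : ∀ t ∈ Set.Icc (0 : ℝ) 1, (∫ φ : ι → ℝ, Real.exp (-(φ ⬝ᵥ ((P + t • D) *ᵥ φ)) / 2)) ≠ 0 :=
    fun t ht => (gaussian_second_moment ι _ (hseg t ht)).1.ne'
  have hcont : ContinuousOn f' (Set.uIcc (0 : ℝ) 1) := by
    rw [Set.uIcc_of_le zero_le_one]
    exact continuousOn_const.mul (continuousOn_finsetSum _ fun a _ => continuousOn_finsetSum _ fun b _ =>
      (hentry a b).mul ((hNc a b).div hZc hZne))
  have hFTC := intervalIntegral.integral_eq_sub_of_hasDerivAt hderivf hcont.intervalIntegrable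
  rw [hFTC]
  simp only [hf, one_smul, zero_smul, add_zero]

end Summit.QuantumFields.YangMills.Theorems.AnchorGap

end
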